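import Summits.NavierStokesRegularity.FluidComputer.GateBudgetPulseClock
import HarnessLib

/-!
# What no tuning can beat, part 65: THE FINE PULSE — the pulse of a headline member lasts at
# most `241 log K/K¹⁰`, not `242/K⁹` (law 3′ of the misfire ladder (20′d′), SPEC-INPUT-bp1 §BE):
# part 55 §163 rounded the horizon-free pulse budget `8 log(17εK¹⁰/(8ρ²))/K¹⁰ + Δ_B` to `242/K⁹`
# with `log K ≤ K`; kept symbolic it is `≤ (240 log K + 2)/K¹⁰ ≤ 241 log K/K¹⁰`, and parts 55
# §165 / 61 §190 re-run with the fine budget hand the rung map a pulse length — hence an output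
# growth `K(T' - r) ≤ 241 log K/K⁹` and a carrier-phase drift `∝ (T' - r)` — smaller by the
# factor `242K/(241 log K)` (`≈ 5.8` at `K = 16`, `≈ 18` at `K = 100`)

Cell `pub-fluidc`, blueprint seat bp1 (gen 35, sixth item, file 1 of 3); same namespace and
conventions as parts 1–64 (`GateBudget*.lean`); imports part 61 (`GateBudgetPulseClock`: §187
`pulse_clock_numerics`, §188 `knob_pulse_clock_kept`, §189 `knob_pulse_trigger_floor`) and
through it part 55 (`GateBudgetPulseFree`: §164 `dousing_level_small`,
`exit_clock_of_kept_radius`, `knob_horizon_ring_cap`), part 54 (§162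
`knob_pulse_window_free`), part 53 (§158 `knob_radius_kept_free`), part 18
(`knob_output_growth`) and `headline_pow_floor`. Headline knob family `rotorCircuit K K¹⁰ ε ρ`
(`M = K¹⁰`) from (5.6), modes `0 = a`, `1 = b` clock, `2 = c` trigger, `3 = d`, `4 = ã`;
`λ₀ = 1/K¹⁰ + 4e^{-K¹⁰}/K¹⁰`. HONEST FRAMING (verbatim): low prior, high value-of-information
experiment on Tao's machine paradigm; NOT a claim that NS blows up. Nothing is proved about
the Navier–Stokes equations.

## Why (SPEC-INPUT-bp1 §BD(4) corrected, §BE: the binding error of the ladder is the pulse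
## LENGTH, and it is `O(log K/K¹⁰)`, not `O(1/K⁹)`)

The misfire ladder of parts 63/64 dies when the pair ledger `P(rₙ₊₁) ≤ P(rₙ) + 0.3(δ₀ +
1210/K⁸) + 6/K⁹` exhausts the window `P ≤ 1/50`: `N ≍ 3.3·10⁻⁵K⁸`, and for small lattice index
the absolute `1210/K⁸ = 968/K⁸ + 242/K⁸` of part 52 §154 dominates. Both pieces are `K ×` or
`4K ×` the pulse length `T' - r ≤ 242/K⁹`: the output grows by `K∫d² ≤ K(T' - r)` (and no
better in kind — during the pulse the rotor turns `(a, d)` by the pinned angle `≈ kπ`, so `d ≈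
±1` mid-pulse whenever `k ≥ 1`), and part 14's carrier-phase drift is `2(ε + σ + Kã(T'))(T' -
r)`. The pulse length itself, however, was ROUNDED: part 54 §162 bounds it by `Δ_A + Δ_B + Δ_C`
with `Δ_A = Δ_C = 4 log(17εK¹⁰/(8ρ²))/K¹⁰ ≤ 120 log K/K¹⁰` on the window `ρ² ≥ 200ε/K²⁰`
(`17εK¹⁰/(8ρ²) ≤ 17K³⁰/1600 ≤ K³⁰`) and `Δ_B = 1/(2(169K¹⁰/400 - 1)) ≤ 2/K¹⁰ ≤ log K/K¹⁰`,
and part 55 §163 then spent `log K ≤ K - 1`. Keeping `log K`: `T' - r ≤ 241 log K/K¹⁰`.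

## What is proved

* §202 `pulse_budget_fine`: `K ≥ 16`, `0 < ε`, `0 < ρ`, `200ε/K²⁰ ≤ ρ²` ⇒ `Δ_A + Δ_B + Δ_C ≤
  241 log K/K¹⁰ ≤ 242/K⁹` (`2 ≤ log K` from `e² < 7.4 ≤ 16 ≤ K`).
* §203 `knob_pulse_free_fine`: part 55 §165 verbatim (same hypotheses, same dousing time `T'`
  of part 54 §162) with the extra conclusion `T' - r ≤ 241 log K/K¹⁰`.
* §204 `knob_pulse_exit_fine`: part 61 §190 verbatim (ignition `b(r) = θ₁ε`, `5/4 ≤ θ₁ ≤ 3/2`,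
  `c(r) = ρ²/K⁹` on the window `200ε/K²⁰ ≤ ρ² ≤ 2ε/K¹⁰`) with the extra conclusion `T' - r ≤
  241 log K/K¹⁰`; everything else (`c > 0` on `[r, T']`, `c(T') ≤ λ₀ρ² ≤ 2ρ²/K¹⁰`, the floor
  `(ρ²/K⁹)e^{-485K} ≤ c(T')`, the exit clock `b(T') = -θ'ε`, `|θ' - θ₁| ≤ 243/K⁹`, the kept
  radius, `ã(T') ≤ ã(r) + K(T' - r)`) exactly as in §190, so part 66 can run part 63 §197's
  proof unchanged around it.

HONEST LIMITS. (i) `241 log K/K¹⁰` is uniform on the window; at a given rung the true bound is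
`(8 log(17εK¹⁰/(8ρ²)) + 2)/K¹⁰ ≈ (160 log K + 8 log(17k/8))/K¹⁰` for lattice index `k`, and the
pulse PROPER (trigger `≥ ε`-ish) is far shorter still — the logarithm is the slow exponential
climb of the trigger from `ρ²/K⁹`, during which `d² ≪ 1`; a phase-resolved output law (`K∫d²`
over the climb) is NOT attempted here; (ii) the clock amplitude `243/K⁹` of §188 and the floor
`485K` of §189 are left at part 61's values (they consume `T' - r ≤ 242/K⁹`, still exported);
(iii) headline family `M = K¹⁰`, `K ≥ 16`, window `200ε/K²⁰ ≤ ρ²`, `K¹⁰ρ² ≤ 2ε`; (iv) nothing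
about Navier–Stokes.
[cite: Tao2016AveragedNS, §5.5 Theorem 5.3, (5.5), (5.6), (b-eq), (c-eq), proof (ob-2), (est)]
-/

noncomputable section

namespace Summit.NavierStokesRegularity.FluidComputer.GateBudget

open Real Set Filter Topology
open Literature.Analysis.FluidPDE.Tao2016AveragedNS

/-! ## §202 The fine pulse budget -/

/-- **THE PULSE BUDGET, FINE.** `K ≥ 16`, `0 < ε`, `0 < ρ`, `200ε/K²⁰ ≤ ρ²`: with `β = ε/4`,
`γ = 13ε/20`, `λ₁ = λ = 1/K¹⁰`, `c_M = 17ε/8`, `M = K¹⁰` the three residences of part 54 §162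
total `≤ 241 log K/K¹⁰ ≤ 242/K⁹` (`17εK¹⁰/(8ρ²) ≤ K³⁰`: `Δ_A = Δ_C ≤ 120 log K/K¹⁰`; `Δ_B ≤
2/K¹⁰ ≤ log K/K¹⁰` as `e² ≤ K`; `log K ≤ K - 1`). [cite: Tao2016AveragedNS, §5.5 proof (ob-2)] -/
theorem pulse_budget_fine {K ε ρ : ℝ} (hK : 16 ≤ K) (hε : 0 < ε) (hρ : 0 < ρ)
    (hlo : 200 * ε / K ^ 20 ≤ ρ ^ 2) :
    ε * log (17 * ε / 8 / (1 / K ^ 10 * ρ ^ 2)) / (K ^ 10 * (ε / 4))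
      + 2 * ε * (ε / 4) / (K ^ 10 * (13 * ε / 20) ^ 2 - ε ^ 2)
      + ε * log (17 * ε / 8 / (1 / K ^ 10 * ρ ^ 2)) / (K ^ 10 * (ε / 4)) ≤ 241 * log K / K ^ 10
    ∧ 241 * log K / K ^ 10 ≤ 242 / K ^ 9 := by
  have hK0 : 0 < K := by linarith
  have hK10 : 0 < K ^ 10 := by positivity
  have hK9 : 0 < K ^ 9 := by positivity
  have h10 : (1099511627776 : ℝ) ≤ K ^ 10 := by
    have := headline_pow_floor hK 10; norm_num at this; exact this
  have hρ2 : 0 < ρ ^ 2 := by positivity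
  have hε2 : 0 < ε ^ 2 := by positivity
  -- `2 ≤ log K`: `e < 2.72`, so `e² < 7.4 ≤ K`
  have hlog2 : (2 : ℝ) ≤ log K := by
    have h1 : exp (2 : ℝ) = exp 1 ^ 2 := by
      rw [← Real.exp_nat_mul]; norm_num
    have h2 := Real.exp_one_lt_d9
    have h3 : 0 < exp (1 : ℝ) := Real.exp_pos 1
    have hexp2 : exp (2 : ℝ) ≤ K := by rw [h1]; nlinarith [h2, h3, hK]
    have h4 : log (exp 2) ≤ log K := Real.log_le_log (Real.exp_pos 2) hexp2
    rwa [Real.log_exp] at h4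
  have hlogK : log K ≤ K - 1 := Real.log_le_sub_one_of_pos hK0
  set Lg := log (17 * ε / 8 / (1 / K ^ 10 * ρ ^ 2)) with hLg
  -- the logarithm: `17εK¹⁰/(8ρ²) ≤ K³⁰`, so `Lg ≤ 30 log K`
  have hlo' : 200 * ε ≤ ρ ^ 2 * K ^ 20 := (div_le_iff₀ (by positivity)).1 hlo
  have harg0 : 0 < 17 * ε / 8 / (1 / K ^ 10 * ρ ^ 2) := by positivity
  have harg : 17 * ε / 8 / (1 / K ^ 10 * ρ ^ 2) ≤ K ^ 30 := by
    rw [div_le_iff₀ (by positivity)]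
    have e : K ^ 30 * (1 / K ^ 10 * ρ ^ 2) = ρ ^ 2 * K ^ 20 := by
      field_simp
    rw [e]
    linarith
  have hLgb : Lg ≤ 30 * log K := by
    have h1 : Lg ≤ log (K ^ 30) := log_le_log harg0 harg
    rw [Real.log_pow] at h1
    push_cast at h1
    linarith [h1]
  have hA : ε * Lg / (K ^ 10 * (ε / 4)) = 4 * Lg / K ^ 10 := by
    field_simp
  have hA' : 4 * Lg / K ^ 10 ≤ 120 * log K / K ^ 10 :=
    div_le_div_of_nonneg_right (by linarith) hK10.le
  -- the transit term
  have hεK : ε ^ 2 * 1099511627776 ≤ ε ^ 2 * K ^ 10 := mul_le_mul_of_nonneg_left h10 hε2.le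
  have hD : 0 < K ^ 10 * (13 * ε / 20) ^ 2 - ε ^ 2 := by nlinarith [hεK, hε2]
  have hB : 2 * ε * (ε / 4) / (K ^ 10 * (13 * ε / 20) ^ 2 - ε ^ 2) ≤ 2 / K ^ 10 := by
    rw [div_le_div_iff₀ hD hK10]
    nlinarith [hεK, hε2]
  rw [hA]
  refine ⟨?_, ?_⟩
  · calc 4 * Lg / K ^ 10 + 2 * ε * (ε / 4) / (K ^ 10 * (13 * ε / 20) ^ 2 - ε ^ 2)
          + 4 * Lg / K ^ 10
        ≤ 120 * log K / K ^ 10 + 2 / K ^ 10 + 120 * log K / K ^ 10 := by linarith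
      _ = (240 * log K + 2) / K ^ 10 := by ring
      _ ≤ 241 * log K / K ^ 10 := div_le_div_of_nonneg_right (by linarith) hK10.le
  · rw [div_le_div_iff₀ hK10 hK9]
    have e : (242 : ℝ) * K ^ 10 = 242 * K * K ^ 9 := by ring
    rw [e]
    have h1 : 241 * log K ≤ 242 * K := by nlinarith [hlogK, hK0]
    nlinarith [h1, hK9]

variable {K ε ρ : ℝ} {X : ℝ → Fin 5 → ℝ}

/-! ## §203 The pulse of a member at any time, fine -/

/-- **THE PULSE OF A MEMBER AT ANY TIME, FINE.** Part 55 §165 with the pulse length kept at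
`241 log K/K¹⁰`: headline family `rotorCircuit K K¹⁰ ε ρ`, `K ≥ 16`, `0 < ε`, `0 < ρ`,
`200ε/K²⁰ ≤ ρ²`, `K¹⁰ρ² ≤ 2ε`, the trajectory from (5.6); ANY time `r ≥ 0` with entry clock
`b(r) ≥ θ₁ε` (`θ₁ ≥ 5/4`), lit trigger `c(r) ≥ ρ²/K¹⁰` and entry radius `b(r)² + c(r)² ≤ 4ε²`.
Then there is a dousing time `T'` with `r < T'`, `T' - r ≤ 242/K⁹`, `T' - r ≤ 241 log K/K¹⁰`,
`T' < r + 1/16`, `c > 0` on `[r, T']`, `c(T') ≤ (1/K¹⁰ + 4e^{-K¹⁰}/K¹⁰)ρ²`, `b(T') ≤ -(θ₁ -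
10⁻⁵)ε`, `b ≤ -ε/4` on `[T', r + 1/16]`, `|b² + c² - (b(r)² + c(r)²)| ≤ ε²/10⁶` on `[r, T']`,
`ã(T') ≤ ã(r) + K(T' - r)` (the proof of §165 with §202 for §163).
[cite: Tao2016AveragedNS, §5.5 Theorem 5.3, (5.5), (5.6), (b-eq), (c-eq), proof (ob-2)] -/
theorem knob_pulse_free_fine
    (hX : ∀ t, HasDerivAt X (RotorKnob.rotorCircuit K (K ^ 10) ε ρ (X t)) t)
    (h0 : X 0 = delayInit) (hK : 16 ≤ K) (hε : 0 < ε) (hρ : 0 < ρ)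
    (hlo : 200 * ε / K ^ 20 ≤ ρ ^ 2) (hhi : K ^ 10 * ρ ^ 2 ≤ 2 * ε)
    {r θ₁ : ℝ} (hr : 0 ≤ r) (hθ₁ : 5 / 4 ≤ θ₁) (hbr : θ₁ * ε ≤ X r 1)
    (hcr : ρ ^ 2 / K ^ 10 ≤ X r 2) (hRr : X r 1 ^ 2 + X r 2 ^ 2 ≤ 4 * ε ^ 2) :
    ∃ T' : ℝ, r < T' ∧ T' - r ≤ 242 / K ^ 9 ∧ T' - r ≤ 241 * log K / K ^ 10 ∧
      T' < r + 1 / 16 ∧ (∀ t ∈ Icc r T', 0 < X t 2) ∧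
      X T' 2 ≤ (1 / K ^ 10 + 4 * exp (-K ^ 10) / K ^ 10) * ρ ^ 2 ∧
      X T' 1 ≤ -((θ₁ - 1 / 10 ^ 5) * ε) ∧
      (∀ t ∈ Icc T' (r + 1 / 16), X t 1 ≤ -(ε / 4)) ∧
      (∀ t ∈ Icc r T', |X t 1 ^ 2 + X t 2 ^ 2 - (X r 1 ^ 2 + X r 2 ^ 2)| ≤ ε ^ 2 / 10 ^ 6) ∧
      X T' 4 ≤ X r 4 + K * (T' - r) := by
  have hK0 : 0 < K := by linarith
  have hK10 : 0 < K ^ 10 := by positivity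
  have h10 : (1099511627776 : ℝ) ≤ K ^ 10 := by
    have := headline_pow_floor hK 10; norm_num at this; exact this
  have h9 : (68719476736 : ℝ) ≤ K ^ 9 := by
    have := headline_pow_floor hK 9; norm_num at this; exact this
  have hK9 : 0 < K ^ 9 := by positivity
  have hρ2 : 0 < ρ ^ 2 := by positivity
  have hρε : ρ ^ 2 ≤ ε := by nlinarith [mul_le_mul_of_nonneg_right h10 hρ2.le]
  have hε2 : 0 < ε ^ 2 := by positivity
  have hεK : ε ^ 2 * 1099511627776 ≤ ε ^ 2 * K ^ 10 := mul_le_mul_of_nonneg_left h10 hε2.le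
  have hθε : 5 / 4 * ε ≤ θ₁ * ε := mul_le_mul_of_nonneg_right hθ₁ hε.le
  -- part 55 §164: the cap `17ε/8` and the ring `((θ₁ - 1/8)ε)²` on the horizon `[r, r + 1/16]`
  have hrc := knob_horizon_ring_cap hX h0 hK10.le hε hρε hr (by linarith) hbr hRr
  -- the fine budget (§202) and the window (part 54 §162)
  have hbud := pulse_budget_fine hK hε hρ hlo
  have h242 : (242 : ℝ) / K ^ 9 < 1 / 16 := by
    rw [div_lt_div_iff₀ hK9 (by norm_num)]
    linarith
  have hu₁ : 1 / K ^ 10 * ρ ^ 2 ≤ X r 2 := by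
    rw [show 1 / K ^ 10 * ρ ^ 2 = ρ ^ 2 / K ^ 10 by ring]; exact hcr
  have hγϱ : (13 * ε / 20) ^ 2 + (ε / 4) ^ 2 ≤ ((θ₁ - 1 / 8) * ε) ^ 2 := by
    have h98 : 9 / 8 * ε ≤ (θ₁ - 1 / 8) * ε := by linarith
    have := pow_le_pow_left₀ (by positivity) h98 2
    nlinarith [hε2]
  obtain ⟨t₁, t₂, T', h01, h12, h2T, hTΔ, hTH, -, -, -, -, hdead, hcT, -, hcpos⟩ :=
    knob_pulse_window_free hX h0 hε hρ hρε hK10 (s₀ := r) (H := 1 / 16) (β := ε / 4)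
      (ϱ := (θ₁ - 1 / 8) * ε) (γ := 13 * ε / 20) (lam₁ := 1 / K ^ 10) (lam := 1 / K ^ 10)
      (cM := 17 * ε / 8) hr (by norm_num) (by positivity) (by linarith) (by positivity) hγϱ
      (by nlinarith [hεK, hε2]) (fun t ht => (hrc t ht).2) (fun t ht => (hrc t ht).1) hu₁
      (by positivity) le_rfl (by linarith)
  have hτf : T' - r ≤ 241 * log K / K ^ 10 := hTΔ.trans hbud.1
  have hτ : T' - r ≤ 242 / K ^ 9 := hτf.trans hbud.2
  -- the kept radius (part 53 §158), the dousing level and the exit clock (part 55 §164)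
  have hkept := knob_radius_kept_free hX h0 hK10.le hε hρε hK hr hτ hRr
  have hcT' : X T' 2 ≤ (1 / K ^ 10 + 4 * exp (-K ^ 10) / K ^ 10) * ρ ^ 2 := by
    have e : ε * exp (-K ^ 10) / (K ^ 10 * (ε / 4)) = 4 * exp (-K ^ 10) / K ^ 10 := by
      rw [div_eq_div_iff (by positivity) (by positivity)]
      ring
    rw [e] at hcT
    exact hcT
  have hbT : X T' 1 ≤ -((θ₁ - 1 / 10 ^ 5) * ε) :=
    exit_clock_of_kept_radius hε hθ₁ hbr (abs_le.1 (hkept T' ⟨by linarith, le_rfl⟩)).1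
      (RotorKnob.c_nonneg hX h0 (by linarith)) (hcT'.trans (dousing_level_small hK hρ hhi))
      (by linarith [hdead T' ⟨h2T, hTH.le⟩])
  exact ⟨T', by linarith, hτ, hτf, hTH, fun t ht => hcpos t ⟨ht.1, by linarith [ht.2]⟩, hcT',
    hbT, fun t ht => hdead t ⟨by linarith [ht.1], ht.2⟩, hkept,
    knob_output_growth hX h0 hK0.le (by linarith)⟩

/-! ## §204 The pulse half of a rung, fine -/

/-- **THE PULSE HALF OF A RUNG, FINE.** Part 61 §190 with the pulse length kept at `241 log
K/K¹⁰`: on the window `200ε/K²⁰ ≤ ρ²`, `K¹⁰ρ² ≤ 2ε`, from an ignition `r ≥ 0` with `b(r) =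
θ₁ε`, `5/4 ≤ θ₁ ≤ 3/2`, `c(r) = ρ²/K⁹`: the dousing time `T'` of §203 exists with `r < T'`,
`T' - r ≤ 242/K⁹`, `T' - r ≤ 241 log K/K¹⁰`, `c > 0` on `[r, T']`, `c(T') ≤ (1/K¹⁰ +
4e^{-K¹⁰}/K¹⁰)ρ² ≤ 2ρ²/K¹⁰`, `(ρ²/K⁹)e^{-485K} ≤ c(T')`, the exit clock `b(T') = -θ'ε` with
`θ₁ - 243/K⁹ ≤ θ' ≤ θ₁ + 243/K⁹`, the kept radius `|Δ(b² + c²)| ≤ ε²/10⁶` on `[r, T']` and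
`ã(T') ≤ ã(r) + K(T' - r)` (the proof of §190 with §203 for part 55 §165).
[cite: Tao2016AveragedNS, §5.5 Theorem 5.3, (5.5), (5.6), proof (ob-2)] -/
theorem knob_pulse_exit_fine
    (hX : ∀ t, HasDerivAt X (RotorKnob.rotorCircuit K (K ^ 10) ε ρ (X t)) t)
    (h0 : X 0 = delayInit) (hK : 16 ≤ K) (hε : 0 < ε) (hρ : 0 < ρ)
    (hlo : 200 * ε / K ^ 20 ≤ ρ ^ 2) (hhi : K ^ 10 * ρ ^ 2 ≤ 2 * ε) {r θ₁ : ℝ} (hr : 0 ≤ r)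
    (hθ₁ : 5 / 4 ≤ θ₁) (hθ₁' : θ₁ ≤ 3 / 2) (hbr : X r 1 = θ₁ * ε)
    (hcr : X r 2 = ρ ^ 2 / K ^ 9) :
    ∃ T' θ' : ℝ, r < T' ∧ T' - r ≤ 242 / K ^ 9 ∧ T' - r ≤ 241 * log K / K ^ 10 ∧
      (∀ t ∈ Icc r T', 0 < X t 2) ∧
      X T' 2 ≤ (1 / K ^ 10 + 4 * exp (-K ^ 10) / K ^ 10) * ρ ^ 2 ∧
      X T' 2 ≤ 2 * ρ ^ 2 / K ^ 10 ∧ ρ ^ 2 / K ^ 9 * exp (-(485 * K)) ≤ X T' 2 ∧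
      X T' 1 = -(θ' * ε) ∧ θ₁ - 243 / K ^ 9 ≤ θ' ∧ θ' ≤ θ₁ + 243 / K ^ 9 ∧
      (∀ t ∈ Icc r T', |X t 1 ^ 2 + X t 2 ^ 2 - (X r 1 ^ 2 + X r 2 ^ 2)| ≤ ε ^ 2 / 10 ^ 6) ∧
      X T' 4 ≤ X r 4 + K * (T' - r) := by
  have hK0 : (0 : ℝ) < K := by linarith
  have hK1 : (1 : ℝ) ≤ K := by linarith
  obtain ⟨hN, hρε, hlam⟩ := pulse_clock_numerics hK hε hρ hhi
  have hRr : X r 1 ^ 2 + X r 2 ^ 2 ≤ 4 * ε ^ 2 := by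
    rw [hbr, hcr]
    have h1 : (θ₁ * ε) ^ 2 ≤ (3 / 2 * ε) ^ 2 :=
      pow_le_pow_left₀ (by positivity) (by nlinarith only [hθ₁', hε]) 2
    have h2 : ρ ^ 2 / K ^ 9 ≤ ε := by
      calc ρ ^ 2 / K ^ 9 ≤ ρ ^ 2 := div_le_self (sq_nonneg ρ) (one_le_pow₀ hK1)
        _ ≤ ε := hρε
    have h3 : (ρ ^ 2 / K ^ 9) ^ 2 ≤ ε ^ 2 := pow_le_pow_left₀ (by positivity) h2 2
    nlinarith only [h1, h3, hε]
  have hbr' : θ₁ * ε ≤ X r 1 := hbr.ge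
  have hcr' : ρ ^ 2 / K ^ 10 ≤ X r 2 := by
    rw [hcr]
    exact div_le_div_of_nonneg_left (sq_nonneg ρ) (by positivity)
      (pow_le_pow_right₀ hK1 (by norm_num))
  obtain ⟨T', hrT, hτ, hτf, -, hpos, hcT, hbT, -, hkept, hgrow⟩ :=
    knob_pulse_free_fine hX h0 hK hε hρ hlo hhi hr hθ₁ hbr' hcr' hRr
  have hcT2 : X T' 2 ≤ 2 * ρ ^ 2 / K ^ 10 := hcT.trans hlam
  have hbT0 : X T' 1 ≤ 0 := by
    have : 0 ≤ (θ₁ - 1 / 10 ^ 5) * ε := by nlinarith only [hθ₁, hε]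
    linarith only [hbT, this]
  have hb0 : 0 ≤ X r 1 := by rw [hbr]; positivity
  obtain ⟨hlow, hupp⟩ := knob_pulse_clock_kept hX h0 hK hε hρ hhi hr hrT.le hτ hb0 hcr.le
    hbT0 hcT2
  have hfl := knob_pulse_trigger_floor hX h0 hK hε hρε hr hrT.le hτ hRr (by rw [hcr]; positivity)
  rw [hcr] at hfl
  refine ⟨T', -X T' 1 / ε, hrT, hτ, hτf, hpos, hcT, hcT2, hfl, ?_, ?_, ?_, hkept, hgrow⟩
  · field_simp
  · rw [le_div_iff₀ hε]
    have : (θ₁ - 243 / K ^ 9) * ε = θ₁ * ε - 243 * ε / K ^ 9 := by ring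
    rw [this, ← hbr]
    exact hlow
  · rw [div_le_iff₀ hε]
    have : (θ₁ + 243 / K ^ 9) * ε = θ₁ * ε + 243 * ε / K ^ 9 := by ring
    rw [this, ← hbr]
    exact hupp

end Summit.NavierStokesRegularity.FluidComputer.GateBudget
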